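import Summits.RiemannHypothesis.RiemannHypothesis.Theses.WeilWindowFlow
import Summits.RiemannHypothesis.RiemannHypothesis.Theorems.GronwallLeakage.Negative.Structure
import Summits.RiemannHypothesis.RiemannHypothesis.Theorems.GronwallLeakage.Negative.LoadBearing
import Summits.RiemannHypothesis.RiemannHypothesis.Theorems.WeilWindowFlowGronwallLeakageIffRH
import Literature.NumberTheory.LFunctions.WeilWindowSuzukiContinuityProofs
import Literature.NumberTheory.DiophantineGeometry.NamedHypotheses

/-!
# STRATEGY-CENSUS sketch — crux `WeilWindowFlow.GronwallLeakage` (stmt-RiemannHypothesis-1037)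

Typed forms of the census attempts (planner-cstrat-stmt-RiemannHypothesis-1037-0, 2026-08-16).
Nothing here is a registered line: every statement below either implies the crux only together
with a piece that is the crux in substance, or is ≥ RH by itself (see STRATEGY-CENSUS.md).
The glue theorems are sorry-free and show exactly which piece carries the Riemann hypothesis.
(Self-contained w.r.t. the MaximalFlow file, whose olean was unbuilt on the farm at census time:
the two "no conjugate point" criteria are re-derived here from IffRH + LoadBearing + continuity.)
-/

set_option linter.dupNamespace false

noncomputable section

open MeasureTheory Set Filter Topology
open Literature.NumberTheory.LFunctions
open Literature.NumberTheory.DiophantineGeometry (RiemannHypothesisUpTo)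
open Summit.RiemannHypothesis.RiemannHypothesis.Theses.WeilWindowFlow (GronwallLeakage)
open Summit.RiemannHypothesis.RiemannHypothesis.Theorems.WeilWindowFlowGronwallLeakage
open Summit.RiemannHypothesis.Cruxes.GronwallLeakage.Negative

namespace Summit.RiemannHypothesis.RiemannHypothesis.Cruxes.GronwallLeakage.StrategyCensus

local notation "ε" => weilGroundEnergy

/-! ## §0 Two criteria for the crux (light re-derivation of the MaximalFlow package) -/

/-- `ε ≥ 0` at every window already gives the crux (Yoshida's criterion + `X ↔ RH`). -/
theorem gronwallLeakage_of_forall_nonneg (h : ∀ a : ℝ, 0 < a → 0 ≤ ε a) : GronwallLeakage :=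
  gronwallLeakage_iff_riemannHypothesis.2
    (riemannHypothesis_iff_forall_weilPositivityOn.2 fun a ha ↦
      (weilGroundEnergy_nonneg_iff_holds ha).1 (h a ha))

/-- No conjugate point (`ε a ≠ 0` for all `a > 0`) gives the crux: otherwise RH fails, `ε a₁ < 0` at some
window, `ε > 0` near `0⁺`, and the intermediate value theorem (continuity of `ε` on `(0, ∞)`) produces a zero. -/
theorem gronwallLeakage_of_forall_ne_zero (h : ∀ a : ℝ, 0 < a → ε a ≠ 0) : GronwallLeakage := by
  by_contra hX
  have hRH : ¬ _root_.RiemannHypothesis := fun hR ↦ hX (gronwallLeakage_iff_riemannHypothesis.2 hR)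
  obtain ⟨a₁, ha₁, hneg⟩ := exists_weilGroundEnergy_neg_of_not_riemannHypothesis hRH
  obtain ⟨a₀, ha₀, hpos⟩ := exists_weilGroundEnergy_pos
  have hlt : a₀ < a₁ := by
    by_contra hle
    push Not at hle
    exact (hpos a₁ ha₁ hle).not_gt hneg
  have hcont : ContinuousOn weilGroundEnergy (Icc a₀ a₁) := fun x hx ↦
    (continuousAt_weilGroundEnergy (ha₀.trans_le hx.1)).continuousWithinAt
  have hmem : (0 : ℝ) ∈ Icc (ε a₁) (ε a₀) := ⟨hneg.le, (hpos a₀ ha₀ le_rfl).le⟩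
  obtain ⟨c, hc, hc0⟩ := intermediate_value_Icc' hlt.le hcont hmem
  exact h c (ha₀.trans_le hc.1) hc0

/-! ## §Strengthen -/

/-- **S⁺₁ (explicit envelope / Connes prolate law as a two-window inequality).** On every range
`[b₀, ∞)` the bottom leaks at most at the rate `8π e^{2x} + K`:
`ε a ≥ ε b · exp(−4π(e^{2a} − e^{2b}) − K(a − b))`. Stronger than the crux (it pins the rate). -/
def ExplicitEnvelopeLeakage : Prop :=
  ∀ b₀ : ℝ, 0 < b₀ → ∃ K : ℝ, ∀ b a : ℝ, b₀ ≤ b → b ≤ a →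
    ε b * Real.exp (-(4 * Real.pi * (Real.exp (2 * a) - Real.exp (2 * b)) + K * (a - b))) ≤ ε a

/-- S⁺₁ ⟹ crux (hence S⁺₁ ⟹ RH): transport the proved small-window positivity
(`exists_weilGroundEnergy_pos`) along the envelope; conclude by `gronwallLeakage_of_forall_ne_zero`. -/
theorem gronwallLeakage_of_explicitEnvelope (h : ExplicitEnvelopeLeakage) : GronwallLeakage := by
  refine gronwallLeakage_of_forall_ne_zero fun a ha ↦ ?_
  obtain ⟨a₁, ha₁, H⟩ := exists_weilGroundEnergy_pos
  by_cases hle : a ≤ a₁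
  · exact (H a ha hle).ne'
  · obtain ⟨K, hK⟩ := h a₁ ha₁
    have h1 := hK a₁ a le_rfl (le_of_not_ge hle)
    exact (lt_of_lt_of_le (mul_pos (H a₁ ha₁ le_rfl) (Real.exp_pos _)) h1).ne'

/-- **S⁺₂ (log-convexity between prime-power entries).** On each inter-entry window range
`((log n)/2, (log(n+1))/2)` — where the arithmetic seen by the form is frozen — `log ε` is convex
wherever `ε > 0`. Would imply RH by a tangent-line argument at a first conjugate point; numerically
FALSE in the variables `a` and `μ = e^{2a}` (kit j013407/j013492: the rate climbs inside each step). -/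
def InterEntryLogConvex : Prop :=
  ∀ n : ℕ, 1 ≤ n →
    ConvexOn ℝ (Ioo (Real.log n / 2) (Real.log (n + 1) / 2) ∩ {x | 0 < ε x}) fun x ↦ Real.log (ε x)

/-! ## §Decomposition -/

/-- **Sub_T (no transversal conjugate point):** the bottom never reaches `0` with a left slope
bounded away from `0`. This is the piece that remains the whole crux in substance (a first
conjugate point is expected to be transversal: Hadamard `−ε′ = κ²`, Hopf-type edge lemma). -/
def NoTransversalConjugatePoint : Prop :=
  ∀ a : ℝ, 0 < a → ε a = 0 → ¬ ∃ c : ℝ, 0 < c ∧ ∀ᶠ h in 𝓝[>] (0 : ℝ), c * h ≤ ε (a - h)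

/-- **Sub_0 (every conjugate point is transversal = Hopf/Hadamard non-degeneracy):** if the
bottom vanishes at `a`, it does so with left slope `≤ −c < 0`. Unconditional-flavoured
(`HopfEdge` of Cruxes/DiniLeakage/Disproof.lean + the Hadamard formula); closes nothing by itself. -/
def ConjugatePointsTransversal : Prop :=
  ∀ a : ℝ, 0 < a → ε a = 0 → ∃ c : ℝ, 0 < c ∧ ∀ᶠ h in 𝓝[>] (0 : ℝ), c * h ≤ ε (a - h)

/-- The split is exact as logic: Sub_T ∧ Sub_0 ⟹ no conjugate point ⟹ crux. -/
theorem gronwallLeakage_of_transversality_split (hT : NoTransversalConjugatePoint)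
    (h0 : ConjugatePointsTransversal) : GronwallLeakage :=
  gronwallLeakage_of_forall_ne_zero fun a ha h ↦ hT a ha h (h0 a ha h)

/-- … and conversely the crux gives both pieces vacuously (no window with `ε a = 0`,
`weilGroundEnergy_pos_of_gronwallLeakage`). -/
theorem transversality_split_of_gronwallLeakage (hX : GronwallLeakage) :
    NoTransversalConjugatePoint ∧ ConjugatePointsTransversal :=
  ⟨fun _ ha h _ ↦ (weilGroundEnergy_pos_of_gronwallLeakage hX ha).ne' h,
   fun _ ha h ↦ ((weilGroundEnergy_pos_of_gronwallLeakage hX ha).ne' h).elim⟩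

/-- **D4 (height ↔ window exchange schema):** RH verified up to height `T` protects the flow up to
the window `α T`. Not in print; heuristically `α T ≈ ½ log (T/(2πe))` (zero-budget count), a proof
would need the same control of high zeros that window positivity itself needs. -/
def WindowFromHeight (α : ℝ → ℝ) : Prop :=
  ∀ T : ℝ, RiemannHypothesisUpTo T → ∀ a : ℝ, 0 < a → a ≤ α T → WeilPositivityOn a

/-- With ANY exchange rate `α` tending to `+∞`, the schema plus "RH up to every height" gives the
crux — but "RH up to every height" is RH (`riemannHypothesis_iff_forall_riemannHypothesisUpTo`),
so the second piece is the summit verbatim. -/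
theorem gronwallLeakage_of_windowFromHeight {α : ℝ → ℝ} (hα : Tendsto α atTop atTop)
    (hW : WindowFromHeight α) (hRH : ∀ T, RiemannHypothesisUpTo T) : GronwallLeakage := by
  refine gronwallLeakage_of_forall_nonneg fun a ha ↦ ?_
  obtain ⟨T, hT⟩ := (hα.eventually (eventually_ge_atTop a)).exists
  exact (weilGroundEnergy_nonneg_iff_holds ha).2 (hW T (hRH T) a ha hT)

end Summit.RiemannHypothesis.RiemannHypothesis.Cruxes.GronwallLeakage.StrategyCensus

end
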